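import Mathlib.LinearAlgebra.Dimension.OrzechProperty
import Literature.NumberTheory.Transcendental.StrongFourExponentialsProofs
import HarnessLib

/-!
# Corollary 2.6 of Waldschmidt 2005 is equivalent to the strong six exponentials theorem

Sibling proof file of `Literature/NumberTheory/Transcendental/StrongFourExponentials.lean`
(named fact `waldschmidt2005_cor_2_6` = [Waldschmidt2005, §2 Corollary 2.6, p. 343]) and of
`StrongFourExponentialsProofs.lean` (the printed reduction
`waldschmidt2005_cor_2_6_of_strongSixExponentials :
  roy1992_strongSixExponentials → waldschmidt2005_cor_2_6`).

This file proves the CONVERSE reduction, `roy1992_strongSixExponentials_of_cor_2_6`, hence the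
equivalence `waldschmidt2005_cor_2_6_iff_strongSixExponentials`: Corollary 2.6 is not a proper
weakening of Theorem 2.1 [Waldschmidt2005, §2 Thm 2.1 = Roy 1992, §4 Cor. 2, the tree's named
fact `Literature.Barriers.Schanuel.roy1992_strongSixExponentials`] but carries its full strength.
The argument is elementary linear algebra and is the printed proof read backwards: a `2 × 3`
matrix `M` with entries in `L̃`, `ℚ̄`-linearly independent rows and `ℚ̄`-linearly independent
columns has rank `2` unless its rows are `ℂ`-proportional, `M₀ = a·M₁`; then `a ∉ ℚ̄` (rows
`ℚ̄`-independent), the row `M₁ = (Λ₂, Λ₃, Λ₄)` is `ℚ̄`-linearly independent (columns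
`ℚ̄`-independent), and with `Λ₁ = M₀₀ = aΛ₂` one has `Λ₁/Λ₂ = a` transcendental while
`Λ₁Λ₃/Λ₂ = M₀₁` and `Λ₁Λ₄/Λ₂ = M₀₂` both lie in `L̃` — contradicting Corollary 2.6. (So the rank-one
matrices `[[Λ₂, Λ₃, Λ₄], [Λ₁, Λ, Λ′]]` of the printed proof [Waldschmidt2005, pp. 343–344] are, up
to the order of the rows, ALL the matrices excluded by Theorem 2.1.)

Consequence for the tree's fact DAG: the discharge `waldschmidt2005_cor_2_6_holds` is exactly as
hard as `roy1992_strongSixExponentials_holds`, whose only unproved input is Waldschmidt's linear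
subgroup theorem `Literature.Barriers.Schanuel.roy1992_thm1` ([Waldschmidt1988, Thm 4.1] for
`G_a^{d₀} × G_m^{d₁}`; the chain `roy1992_thm1 → roy1992_thm2 → roy1992_thm4 → roy1992_cor1 →
roy1992_strongSixExponentials` is proved in `Literature/Barriers/Schanuel/`). No definition and no
named fact is introduced here.

## References

* [Waldschmidt2005] M. Waldschmidt, *Variations on the six exponentials theorem*, in: Algebra and
  Number Theory (Hyderabad 2003), Hindustan Book Agency (2005) 338–355: §2 Theorem 2.1 (p. 342),
  Corollary 2.6 (p. 343) and the proof of Corollaries 2.2–2.6 (pp. 343–344). Held: lit key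
  `paper:doi-10-1007-978-93-86279-23-1-23` (PDF pp. 7–9).
* [Roy1992] D. Roy, *Matrices whose coefficients are linear forms in logarithms*, J. Number
  Theory 41 (1992) 22–47, §4 Corollary 2 (p. 38).
* [Waldschmidt1988] M. Waldschmidt, *On the transcendence methods of Gel'fond and Schneider in
  several variables*, New Advances in Transcendence Theory (A. Baker ed.), CUP 1988, Thm 4.1.
-/

noncomputable section

open Complex Module

namespace Literature.NumberTheory.Transcendental

open Literature.Barriers.Schanuel

/-- A matrix with two rows over a field has rank `2` iff its rows are linearly independent
(`rank M = dim span(rows)`). [folklore] -/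
theorem matrix_rank_eq_two_iff_linearIndependent_rows {n : ℕ} (M : Matrix (Fin 2) (Fin n) ℂ) :
    M.rank = 2 ↔ LinearIndependent ℂ (fun i => M i) := by
  rw [linearIndependent_iff_card_eq_finrank_span, Fintype.card_fin, Set.finrank,
    Matrix.rank_eq_finrank_span_row, Matrix.row_def]
  exact eq_comm

/-- **The strong six exponentials theorem from Corollary 2.6** (converse of the printed reduction
`waldschmidt2005_cor_2_6_of_strongSixExponentials`). Let `M` be a `2 × 3` matrix with entries in
`L̃`, `ℚ̄`-linearly independent rows and `ℚ̄`-linearly independent columns. If `rank M ≠ 2` the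
rows are `ℂ`-proportional, `M₀ = a·M₁` (`M₁ ≠ 0`); `a` is transcendental since the rows are
`ℚ̄`-independent; `M₁ = (Λ₂, Λ₃, Λ₄)` is `ℚ̄`-linearly independent since the columns
`(aΛⱼ, Λⱼ)` are; and with `Λ₁ = M₀₀ = aΛ₂` (`Λ₂ ≠ 0`) Corollary 2.6 asserts that `Λ₁Λ₃/Λ₂ = M₀₁`
or `Λ₁Λ₄/Λ₂ = M₀₂` is not in `L̃`, which is absurd. Together with the printed direction this shows
that Corollary 2.6 is equivalent to Theorem 2.1.
[cite: Waldschmidt2005, §2 Theorem 2.1 (p. 342), Corollary 2.6 (p. 343), proof pp. 343–344] -/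
theorem roy1992_strongSixExponentials_of_cor_2_6 (h : waldschmidt2005_cor_2_6) :
    roy1992_strongSixExponentials := by
  intro M hM hrows hcols
  rw [matrix_rank_eq_two_iff_linearIndependent_rows, linearIndependent_fin2]
  refine ⟨hrows.ne_zero 1, fun a ha => ?_⟩
  -- `ha : a • M 1 = M 0`; read it coordinatewise
  have h0 : ∀ j, M 0 j = a * M 1 j := fun j => by
    have := congr_fun ha j
    simpa [smul_eq_mul] using this.symm
  -- `a` is transcendental: otherwise `M 0 - a • M 1 = 0` is a non-trivial `ℚ̄`-relation between the rows
  have haT : Transcendental ℚ a := by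
    intro halg
    set a' : algebraicClosure ℚ ℂ := ⟨a, mem_algebraicClosure_iff.2 halg⟩ with ha'
    have hrel : ∑ i : Fin 2, (![(1 : algebraicClosure ℚ ℂ), -a'] i) • M i = 0 := by
      rw [Fin.sum_univ_two]
      funext j
      simp only [Matrix.cons_val_zero, Matrix.cons_val_one, Pi.add_apply,
        Pi.smul_apply, IntermediateField.smul_def, smul_eq_mul, Pi.zero_apply, one_smul]
      rw [h0 j]
      simp [ha']
    have h10 := Fintype.linearIndependent_iff.1 hrows ![(1 : algebraicClosure ℚ ℂ), -a'] hrel 0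
    simp at h10
  -- the row `M 1` is `ℚ̄`-linearly independent (read a relation on the columns `(a Λⱼ, Λⱼ)`)
  have hv : LinearIndependent (algebraicClosure ℚ ℂ) (M 1) := by
    rw [Fintype.linearIndependent_iff]
    intro g hg
    refine Fintype.linearIndependent_iff.1 hcols g ?_
    funext i
    simp only [Finset.sum_apply, Pi.smul_apply, Matrix.transpose_apply, Pi.zero_apply]
    revert i
    rw [Fin.forall_fin_two]
    refine ⟨?_, hg⟩
    have hc : ∀ c, g c • M 0 c = a * (g c • M 1 c) := fun c => by
      rw [h0 c, IntermediateField.smul_def, IntermediateField.smul_def, smul_eq_mul, smul_eq_mul]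
      ring
    simp_rw [hc, ← Finset.mul_sum]
    rw [hg, mul_zero]
  have hne : M 1 0 ≠ 0 := hv.ne_zero 0
  have hli3 : LinearIndependent (algebraicClosure ℚ ℂ) ![M 1 0, M 1 1, M 1 2] := by
    have hfun : ![M 1 0, M 1 1, M 1 2] = M 1 := by
      funext j
      fin_cases j <;> rfl
    rw [hfun]
    exact hv
  have hq : M 0 0 / M 1 0 = a := by rw [h0 0, mul_div_cancel_right₀ a hne]
  have e1 : M 0 0 * M 1 1 / M 1 0 = M 0 1 := by
    rw [h0 0, h0 1, mul_right_comm, mul_div_cancel_right₀ _ hne]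
  have e2 : M 0 0 * M 1 2 / M 1 0 = M 0 2 := by
    rw [h0 0, h0 2, mul_right_comm, mul_div_cancel_right₀ _ hne]
  have htr : Transcendental ℚ (M 0 0 / M 1 0) := by
    rw [hq]
    exact haT
  rcases h (M 0 0) (M 1 0) (M 1 1) (M 1 2) (hM 0 0) (hM 1 0) (hM 1 1) (hM 1 2) htr hli3 with h3 | h4
  · exact h3 (by rw [e1]; exact hM 0 1)
  · exact h4 (by rw [e2]; exact hM 0 2)

/-- **Corollary 2.6 ⟺ Theorem 2.1 (strong six exponentials theorem).** The printed direction is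
`waldschmidt2005_cor_2_6_of_strongSixExponentials` (`StrongFourExponentialsProofs.lean`), the
converse is `roy1992_strongSixExponentials_of_cor_2_6` above.
[cite: Waldschmidt2005, §2 Theorem 2.1 (p. 342) and Corollary 2.6 (p. 343)] -/
theorem waldschmidt2005_cor_2_6_iff_strongSixExponentials :
    waldschmidt2005_cor_2_6 ↔ roy1992_strongSixExponentials :=
  ⟨roy1992_strongSixExponentials_of_cor_2_6, waldschmidt2005_cor_2_6_of_strongSixExponentials⟩

end Literature.NumberTheory.Transcendental

end
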